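import Literature.MathematicalPhysics.QuantumManyBody.PeriodicBoseGasSelfConvTaylor
import HarnessLib

/-!
# `0 ≤ W₁ ≤ (1 + C(R/ℓ)²) g` and its consequences for `Ŵ₁`

Topic `Literature/MathematicalPhysics/QuantumManyBody` (provefact
`Literature.MathematicalPhysics.QuantumManyBody.BoseGas.Fournais2020_condensation`, layer `Fournais2020_lemma24`).
With the sharp lower bound `χ*χ ≥ 1 - C|y|²` (`PeriodicBoseGasSelfConvTaylor.lean`), the localised
potential `W₁ = g/(χ*χ)(x/ℓ)`, `g = v(1-ω)` (2.8) of a potential supported in `B(0,R)` satisfies,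
for `C(R/ℓ)² ≤ ½`, the printed "`0 ≤ W₁(x) ≤ (1 + C(R/ℓ)²) g(x)`" [Fournais2020, before (2.42)]
with the constant `2C` (`bigW₁_le_sharp`); hence `∫W₁ ≤ (1 + 2C(R/ℓ)²) 8πa` for a scattering
solution (`lintegral_bigW₁_le_sharp`, (A.5)), the real version `W₁ ∈ L¹` with the same bound, and
`|Ŵ₁(p)| ≤ ∫W₁` for its Fourier transform (`norm_fourier_bigW₁_le`), which is how `Ŵ₁(0)` and
`sup|Ŵ₁|` enter (2.31)–(2.42).

## References

* [Fournais2020] S. Fournais, *Length scales for BEC in the dilute Bose gas*, arXiv:2011.00309,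
  EMS Ser. Congr. Rep. 18 (2021), doi:10.4171/ecr/18-1/7: (2.4), (2.8), (2.31), the bound before (2.42), (A.5).
-/

noncomputable section

open MeasureTheory Set
open scoped ENNReal NNReal FourierTransform

namespace Literature.MathematicalPhysics.QuantumManyBody.BoseGas

variable {v : ℝ → ℝ≥0∞} {ω : Space → ℝ} {χ : Space → ℝ} {ℓ C R : ℝ}

/-- **`W₁ ≤ (1 + 2C(R/ℓ)²) g`** pointwise, for `supp v ⊂ B̄(0,R)`, `χ*χ ≥ 1 - C|y|²` and
`C(R/ℓ)² ≤ ½`. [cite: Fournais2020, the bound before (2.42)] -/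
theorem bigW₁_le_sharp (hR : ∀ r, R < r → v r = 0) (hℓ : 0 < ℓ) (hC : 0 ≤ C)
    (hχC : ∀ y : Space, 1 - C * ‖y‖ ^ 2 ≤ selfConv χ y) (hsmall : C * (R / ℓ) ^ 2 ≤ 1 / 2) (x : Space) :
    bigW₁ v ω χ ℓ x ≤ ENNReal.ofReal (1 + 2 * C * (R / ℓ) ^ 2) * (v ‖x‖ * ENNReal.ofReal (1 - ω x)) := by
  unfold bigW₁
  by_cases hx : ‖x‖ ≤ R
  · obtain ⟨hpos, hinv⟩ := inv_selfConv_le (χ := χ) hC hℓ hχC hsmall hx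
    rw [ENNReal.div_eq_inv_mul, ← ENNReal.ofReal_inv_of_pos hpos]
    exact mul_le_mul_left (ENNReal.ofReal_le_ofReal hinv) _
  · rw [hR _ (not_le.mp hx), zero_mul, ENNReal.zero_div]
    exact zero_le

/-- **`∫W₁ ≤ (1 + 2C(R/ℓ)²) ∫g = (1 + 2C(R/ℓ)²) 8πa`** for a scattering solution.
[cite: Fournais2020, the bound before (2.42), (A.5)] -/
theorem lintegral_bigW₁_le_sharp (hR : ∀ r, R < r → v r = 0) (hℓ : 0 < ℓ) (hC : 0 ≤ C)
    (hχC : ∀ y : Space, 1 - C * ‖y‖ ^ 2 ≤ selfConv χ y) (hsmall : C * (R / ℓ) ^ 2 ≤ 1 / 2)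
    (hω : IsScatteringSolution v ω) :
    ∫⁻ x, bigW₁ v ω χ ℓ x ≤
      ENNReal.ofReal (1 + 2 * C * (R / ℓ) ^ 2) * (ENNReal.ofReal (8 * Real.pi) * scatteringLength v) := by
  rw [← hω.lintegral_g, ← lintegral_const_mul' _ _ ENNReal.ofReal_ne_top]
  exact lintegral_mono fun x => bigW₁_le_sharp hR hℓ hC hχC hsmall x

/-- `W₁` is measurable (local copy of `measurable_bigW₁` of `PeriodicBoseGasEq317.lean`, to keep the
import closure small). [cite: Fournais2020, (2.8)] -/
private theorem measurable_bigW₁_aux (hv : Measurable v) (hωm : Measurable ω) (hχ : IsLocalizationFunction χ) (ℓ : ℝ) :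
    Measurable (bigW₁ v ω χ ℓ) := by
  unfold bigW₁
  refine ((hv.comp measurable_norm).mul (ENNReal.measurable_ofReal.comp (measurable_const.sub hωm))).div ?_
  exact ENNReal.measurable_ofReal.comp (hχ.continuous_selfConv.measurable.comp (measurable_const_smul _))

/-- **`W₁ ∈ L¹(ℝ³)` with `∫W₁ ≤ (1 + 2C(R/ℓ)²) 8πa`** (real version, `Ŵ₁(0) = ∫W₁`).
[cite: Fournais2020, (2.31), the bound before (2.42), (A.5)] -/
theorem integral_toReal_bigW₁_le_sharp (hv : Measurable v) (hR : ∀ r, R < r → v r = 0)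
    (hvi : (∫⁻ x : Space, v ‖x‖) ≠ ⊤) (hℓ : 0 < ℓ) (hC : 0 ≤ C) (hχ : IsLocalizationFunction χ)
    (hχC : ∀ y : Space, 1 - C * ‖y‖ ^ 2 ≤ selfConv χ y) (hsmall : C * (R / ℓ) ^ 2 ≤ 1 / 2)
    (hω : IsScatteringSolution v ω) :
    Integrable (fun x => (bigW₁ v ω χ ℓ x).toReal) ∧
      ∫ x, (bigW₁ v ω χ ℓ x).toReal ≤ (1 + 2 * C * (R / ℓ) ^ 2) * (8 * Real.pi * (scatteringLength v).toReal) := by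
  have hsL : scatteringLength v ≠ ⊤ := by
    refine scatteringLength_ne_top ?_
    rw [lintegral_const_mul' _ _ (ENNReal.inv_ne_top.2 two_ne_zero)]
    exact ENNReal.mul_ne_top (ENNReal.inv_ne_top.2 two_ne_zero) hvi
  have hbound := lintegral_bigW₁_le_sharp hR hℓ hC hχC hsmall hω
  have htop : (∫⁻ x, bigW₁ v ω χ ℓ x) ≠ ⊤ :=
    ne_top_of_le_ne_top (ENNReal.mul_ne_top ENNReal.ofReal_ne_top (ENNReal.mul_ne_top ENNReal.ofReal_ne_top hsL))
      hbound
  have hmeas := measurable_bigW₁_aux hv hω.measurable hχ ℓ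
  refine ⟨integrable_toReal_of_lintegral_ne_top hmeas.aemeasurable htop, ?_⟩
  rw [integral_toReal hmeas.aemeasurable (ae_lt_top hmeas htop)]
  have h := ENNReal.toReal_mono (ENNReal.mul_ne_top ENNReal.ofReal_ne_top
    (ENNReal.mul_ne_top ENNReal.ofReal_ne_top hsL)) hbound
  rw [ENNReal.toReal_mul, ENNReal.toReal_mul, ENNReal.toReal_ofReal (by positivity),
    ENNReal.toReal_ofReal (by positivity)] at h
  exact h

/-- **`|Ŵ₁(p)| ≤ ∫W₁ ≤ (1 + 2C(R/ℓ)²) 8πa`** for every momentum (`W₁ ≥ 0`).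
[cite: Fournais2020, (2.31)–(2.32), the bound before (2.42)] -/
theorem norm_fourier_bigW₁_le_sharp (hv : Measurable v) (hR : ∀ r, R < r → v r = 0)
    (hvi : (∫⁻ x : Space, v ‖x‖) ≠ ⊤) (hℓ : 0 < ℓ) (hC : 0 ≤ C) (hχ : IsLocalizationFunction χ)
    (hχC : ∀ y : Space, 1 - C * ‖y‖ ^ 2 ≤ selfConv χ y) (hsmall : C * (R / ℓ) ^ 2 ≤ 1 / 2)
    (hω : IsScatteringSolution v ω) (p : Space) :
    ‖𝓕 (fun x => ((bigW₁ v ω χ ℓ x).toReal : ℂ)) p‖ ≤ (1 + 2 * C * (R / ℓ) ^ 2) * (8 * Real.pi * (scatteringLength v).toReal) := by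
  obtain ⟨_, hint⟩ := integral_toReal_bigW₁_le_sharp hv hR hvi hℓ hC hχ hχC hsmall hω
  refine (VectorFourier.norm_fourierIntegral_le_integral_norm _ _ _ _ _).trans ?_
  refine le_trans (le_of_eq ?_) hint
  refine integral_congr_ae (ae_of_all _ fun x => ?_)
  simp only [Complex.norm_real, Real.norm_eq_abs, abs_of_nonneg ENNReal.toReal_nonneg]

end Literature.MathematicalPhysics.QuantumManyBody.BoseGas

end
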